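import Mathlib.Topology.Homotopy.HomotopyGroup
import Mathlib.Analysis.Normed.Module.Basic
import HarnessLib

/-!
# Compactly supported representatives of the homotopy groups `πₖ(X, x₀)`

Topic `Literature/AlgebraicTopology/Homotopy`. Mathlib's `π_ k X x₀ = HomotopyGroup (Fin k) X x₀`
is the quotient of the generalized loops `Ω^ (Fin k) X x₀` — maps `(Iᵏ, ∂Iᵏ) → (X, x₀)` on the
unit cube `Fin k → I` — by homotopy rel `∂Iᵏ`. For geometric arguments (affine changes of
coordinates, cutting along hyperplanes, shrinking supports; used in the tree's elementary proof
of the Hurewicz vanishing theorem) it is convenient to represent classes by maps on all of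
`ℝᵏ = Fin k → ℝ` (sup norm) which are constant `= x₀` outside a bounded set:

* `Literature.AlgebraicTopology.Homotopy.CSphere k X x₀`: continuous `φ : ℝᵏ → X` with
  `φ y = x₀` for `‖y‖ ≥ R`, some `R` ("compactly supported spheres"); `CSphere.Homotopic`:
  homotopies through such maps with a uniform bound.
* `CSphere.toGenLoop φ R _`: the generalized loop `φ ∘ stretch R`, `stretch R : Iᵏ → [-R, R]ᵏ`
  the affine stretching; `CSphere.toClass φ : π_ k X x₀`, independent of `R`
  (`toClass_eq`); homotopic spheres have the same class (`Homotopic.toClass_eq`).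
* `CSphere.ofGenLoop f = f ∘ projIcc` (coordinatewise clamping) and
  `toClass_ofGenLoop : toClass (ofGenLoop f) = ⟦f⟧`: every class has compactly supported
  representatives.
* `CSphere.const`, `toClass_const : toClass const = 1`.

Everything is elementary and proved; `[folklore]` (Hatcher, *Algebraic Topology* (2002), §4.1,
p. 340: "maps `(Iⁿ, ∂Iⁿ) → (X, x₀)` are the same as maps of the quotient `Iⁿ/∂Iⁿ = Sⁿ`", here in
the variant `ℝᵏ ∪ {∞} = Sᵏ`).

## References

* A. Hatcher, *Algebraic Topology*, CUP (2002), §4.1, p. 340. [HatcherAT2002]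
-/

noncomputable section

open Set Metric unitInterval Topology
open scoped Topology.Homotopy

universe u

namespace Literature.AlgebraicTopology.Homotopy

/-! ### Generalized loops: a packaging lemma for homotopies rel boundary -/

/-- A homotopy rel `∂Iᴺ` between generalized loops, from an explicit continuous family which is
`x₀` on the boundary at all times. [folklore] -/
theorem genLoop_homotopic_of_fun {N : Type*} {X : Type u} [TopologicalSpace X] {x₀ : X}
    {f g : Ω^ N X x₀} (F : I × (N → I) → X) (hF : Continuous F) (h0 : ∀ y, F (0, y) = f y)
    (h1 : ∀ y, F (1, y) = g y) (hb : ∀ t, ∀ y ∈ Cube.boundary N, F (t, y) = x₀) :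
    GenLoop.Homotopic f g :=
  ⟨{ toFun := F
     continuous_toFun := hF
     map_zero_left := h0
     map_one_left := h1
     prop' := fun t y hy => by
       show F (t, y) = f y
       rw [hb t y hy]
       exact (f.2 y hy).symm }⟩

variable {k : ℕ} {X : Type u} [TopologicalSpace X] {x₀ : X}

/-! ### Compactly supported spheres -/

variable (k X x₀) in
/-- A **compactly supported `k`-sphere** in `X` at `x₀`: a continuous map `ℝᵏ → X` which is
`x₀` outside some bounded set (outside a sup-norm ball). [folklore] -/
structure CSphere where
  /-- the map -/
  toFun : (Fin k → ℝ) → X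
  continuous_toFun : Continuous toFun
  exists_bound' : ∃ R : ℝ, ∀ y, R ≤ ‖y‖ → toFun y = x₀

namespace CSphere

/-- A compactly supported sphere is used as a function. [folklore] -/
instance : CoeFun (CSphere k X x₀) fun _ => (Fin k → ℝ) → X := ⟨CSphere.toFun⟩

/-- A compactly supported sphere is continuous. [folklore] -/
@[continuity, fun_prop]
theorem continuous (φ : CSphere k X x₀) : Continuous φ := φ.continuous_toFun

/-- A compactly supported sphere is `x₀` outside some ball. [folklore] -/
theorem exists_bound (φ : CSphere k X x₀) : ∃ R : ℝ, ∀ y, R ≤ ‖y‖ → φ y = x₀ := φ.exists_bound'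

/-- Unfolding the constructor. [folklore] -/
@[simp] theorem coe_mk (f : (Fin k → ℝ) → X) (h1 h2) : ⇑(CSphere.mk (x₀ := x₀) f h1 h2) = f := rfl

/-- Two compactly supported spheres with the same function are equal. [folklore] -/
@[ext] theorem ext {φ ψ : CSphere k X x₀} (h : ∀ y, φ y = ψ y) : φ = ψ := by
  cases φ; cases ψ; congr; exact funext h

/-- The constant sphere. [folklore] -/
def const : CSphere k X x₀ := ⟨fun _ => x₀, continuous_const, ⟨0, fun _ _ => rfl⟩⟩

/-- The constant sphere is `x₀`. [folklore] -/
@[simp] theorem const_apply (y : Fin k → ℝ) : (const : CSphere k X x₀) y = x₀ := rfl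

/-! ### The affine stretching of the unit cube onto `[-R, R]ᵏ` -/

/-- The affine stretching `Iᵏ → [-R, R]ᵏ`, `y ↦ 2R y - R`. [folklore] -/
def stretch (R : ℝ) (y : Fin k → I) : Fin k → ℝ := fun i => 2 * R * (y i : ℝ) - R

/-- `stretch` is continuous (jointly in `R` and `y`). [folklore] -/
@[fun_prop]
theorem continuous_stretch₂ : Continuous fun p : ℝ × (Fin k → I) => stretch p.1 p.2 :=
  continuous_pi fun i => by unfold stretch; fun_prop

/-- `stretch R` is continuous. [folklore] -/
@[fun_prop]
theorem continuous_stretch (R : ℝ) : Continuous (stretch (k := k) R) :=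
  continuous_stretch₂.comp (Continuous.prodMk_right R)

/-- On the boundary of the cube the stretched point has norm `≥ R` (`R ≥ 0`). [folklore] -/
theorem le_norm_stretch {R : ℝ} (hR : 0 ≤ R) {y : Fin k → I} (hy : y ∈ Cube.boundary (Fin k)) :
    R ≤ ‖stretch R y‖ := by
  obtain ⟨i, hi⟩ := hy
  have h1 : |stretch R y i| = R := by
    rcases hi with hi | hi
    · simp [stretch, hi, abs_of_nonneg hR]
    · simp [stretch, hi]; rw [show 2 * R - R = R by ring, abs_of_nonneg hR]
  calc R = ‖stretch R y i‖ := by rw [Real.norm_eq_abs, h1]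
    _ ≤ ‖stretch R y‖ := norm_le_pi_norm _ i

/-! ### From compactly supported spheres to generalized loops and classes -/

/-- The generalized loop `φ ∘ stretch R` of a compactly supported sphere which is `x₀` outside
the ball of radius `R ≥ 0`. [folklore] -/
def toGenLoop (φ : CSphere k X x₀) (R : ℝ) (hR : 0 ≤ R) (h : ∀ y, R ≤ ‖y‖ → φ y = x₀) :
    Ω^ (Fin k) X x₀ :=
  ⟨⟨fun y => φ (stretch R y), φ.continuous.comp (continuous_stretch R)⟩,
    fun _ hy => h _ (le_norm_stretch hR hy)⟩

/-- Unfolding `toGenLoop`. [folklore] -/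
@[simp] theorem toGenLoop_apply (φ : CSphere k X x₀) (R : ℝ) (hR h) (z : Fin k → I) :
    toGenLoop φ R hR h z = φ (stretch R z) := rfl

/-- A bound can always be taken nonnegative. [folklore] -/
theorem exists_bound_nonneg (φ : CSphere k X x₀) : ∃ R : ℝ, 0 ≤ R ∧ ∀ y, R ≤ ‖y‖ → φ y = x₀ := by
  obtain ⟨R, hR⟩ := φ.exists_bound
  exact ⟨max R 0, le_max_right _ _, fun y hy => hR y ((le_max_left _ _).trans hy)⟩

/-- **The class** of a compactly supported sphere in `πₖ(X, x₀)`. [folklore] -/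
def toClass (φ : CSphere k X x₀) : π_ k X x₀ :=
  ⟦toGenLoop φ _ φ.exists_bound_nonneg.choose_spec.1 φ.exists_bound_nonneg.choose_spec.2⟧

/-- Generalized loops obtained from one sphere with two admissible radii are homotopic.
[folklore] -/
theorem toGenLoop_homotopic (φ : CSphere k X x₀) {R R' : ℝ} (hR : 0 ≤ R) (hR' : 0 ≤ R')
    (h : ∀ y, R ≤ ‖y‖ → φ y = x₀) (h' : ∀ y, R' ≤ ‖y‖ → φ y = x₀) :
    GenLoop.Homotopic (toGenLoop φ R hR h) (toGenLoop φ R' hR' h') := by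
  refine genLoop_homotopic_of_fun (fun p => φ (stretch ((1 - (p.1 : ℝ)) * R + (p.1 : ℝ) * R') p.2))
    (by fun_prop) (fun y => by simp) (fun y => by simp) fun t y hy => ?_
  have ht0 : 0 ≤ (t : ℝ) := t.2.1
  have ht1 : (t : ℝ) ≤ 1 := t.2.2
  have hRt : 0 ≤ (1 - (t : ℝ)) * R + (t : ℝ) * R' := by positivity
  have hle := le_norm_stretch hRt hy
  -- the interpolated radius is at least `min R R'`
  rcases le_total R R' with hRR | hRR
  · exact h _ (le_trans (by nlinarith) hle)
  · exact h' _ (le_trans (by nlinarith) hle)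

/-- The class does not depend on the radius. [folklore] -/
theorem toClass_eq (φ : CSphere k X x₀) {R : ℝ} (hR : 0 ≤ R) (h : ∀ y, R ≤ ‖y‖ → φ y = x₀) :
    φ.toClass = ⟦toGenLoop φ R hR h⟧ :=
  Quotient.sound (toGenLoop_homotopic φ _ hR _ h)

/-- The class of the constant sphere is the identity. [folklore] -/
theorem toClass_const [NeZero k] : (const : CSphere k X x₀).toClass = 1 := by
  rw [toClass_eq const le_rfl fun _ _ => rfl, HomotopyGroup.one_def]
  rfl

/-! ### Homotopies of compactly supported spheres -/

/-- Two compactly supported spheres are **homotopic** if they are joined by a homotopy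
`ℝᵏ × [0, 1] → X` (given as a continuous map on `ℝᵏ × ℝ`) which is `x₀` outside a ball,
uniformly in time. [folklore] -/
def Homotopic (φ ψ : CSphere k X x₀) : Prop :=
  ∃ H : (Fin k → ℝ) × ℝ → X, Continuous H ∧ (∀ y, H (y, 0) = φ y) ∧ (∀ y, H (y, 1) = ψ y) ∧
    ∃ R : ℝ, ∀ y, R ≤ ‖y‖ → ∀ t, H (y, t) = x₀

namespace Homotopic

/-- Reflexivity. [folklore] -/
theorem refl (φ : CSphere k X x₀) : Homotopic φ φ := by
  obtain ⟨R, hR⟩ := φ.exists_bound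
  exact ⟨fun p => φ p.1, by fun_prop, fun _ => rfl, fun _ => rfl, R, fun y hy _ => hR y hy⟩

/-- Symmetry. [folklore] -/
theorem symm {φ ψ : CSphere k X x₀} (h : Homotopic φ ψ) : Homotopic ψ φ := by
  obtain ⟨H, hH, h0, h1, R, hR⟩ := h
  refine ⟨fun p => H (p.1, 1 - p.2), by fun_prop, fun y => by simp [h1], fun y => by simp [h0],
    R, fun y hy t => hR y hy _⟩

/-- Transitivity. [folklore] -/
theorem trans {φ ψ χ : CSphere k X x₀} (h : Homotopic φ ψ) (h' : Homotopic ψ χ) : Homotopic φ χ := by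
  obtain ⟨H, hH, h0, h1, R, hR⟩ := h
  obtain ⟨H', hH', h0', h1', R', hR'⟩ := h'
  refine ⟨fun p => if p.2 ≤ 2⁻¹ then H (p.1, 2 * p.2) else H' (p.1, 2 * p.2 - 1), ?_, ?_, ?_,
    max R R', ?_⟩
  · refine Continuous.if_le ?_ ?_ continuous_snd continuous_const ?_
    · fun_prop
    · fun_prop
    · rintro ⟨y, t⟩ (rfl : t = 2⁻¹)
      norm_num [h1, h0']
  · intro y; norm_num [h0]
  · intro y; norm_num [h1']
  · intro y hy t
    dsimp only
    split_ifs
    · exact hR y ((le_max_left _ _).trans hy) _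
    · exact hR' y ((le_max_right _ _).trans hy) _

/-- A homotopy of compactly supported spheres gives a homotopy rel `∂Iᵏ` of the generalized loops
(same radius). [folklore] -/
theorem toClass_eq {φ ψ : CSphere k X x₀} (h : Homotopic φ ψ) : φ.toClass = ψ.toClass := by
  obtain ⟨H, hH, h0, h1, R, hR⟩ := h
  set R₀ := max R 0 with hR₀
  have hR₀0 : 0 ≤ R₀ := le_max_right _ _
  have hφ : ∀ y, R₀ ≤ ‖y‖ → φ y = x₀ := fun y hy => by
    rw [← h0]; exact hR y ((le_max_left _ _).trans hy) 0
  have hψ : ∀ y, R₀ ≤ ‖y‖ → ψ y = x₀ := fun y hy => by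
    rw [← h1]; exact hR y ((le_max_left _ _).trans hy) 1
  rw [φ.toClass_eq hR₀0 hφ, ψ.toClass_eq hR₀0 hψ]
  refine Quotient.sound (genLoop_homotopic_of_fun (fun p => H (stretch R₀ p.2, p.1))
    (by fun_prop) (fun y => by simp [h0]) (fun y => by simp [h1]) fun t y hy => ?_)
  exact hR _ ((le_max_left _ _).trans (le_norm_stretch hR₀0 hy)) _

end Homotopic

/-- A homotopy of spheres from an explicit family `s ↦ φₛ` of spheres: it suffices that
`(y, s) ↦ φₛ y` be continuous and the spheres be `x₀` outside a common ball. [folklore] -/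
theorem homotopic_of_family (Φ : ℝ → CSphere k X x₀) (hΦ : Continuous fun p : (Fin k → ℝ) × ℝ => Φ p.2 p.1)
    (R : ℝ) (hR : ∀ s ∈ Icc (0 : ℝ) 1, ∀ y, R ≤ ‖y‖ → Φ s y = x₀) : Homotopic (Φ 0) (Φ 1) := by
  refine ⟨fun p => Φ (projIcc 0 1 zero_le_one p.2) p.1, ?_, fun y => by simp, fun y => by simp,
    R, fun y hy t => hR _ (projIcc 0 1 zero_le_one t).2 y hy⟩
  exact hΦ.comp (f := fun p : (Fin k → ℝ) × ℝ => (p.1, ((projIcc 0 1 zero_le_one p.2 : I) : ℝ)))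
    (by fun_prop)

/-! ### From generalized loops to compactly supported spheres -/

/-- Coordinatewise clamping `ℝᵏ → Iᵏ`. [folklore] -/
def clamp (y : Fin k → ℝ) : Fin k → I := fun i => projIcc 0 1 zero_le_one (y i)

/-- Clamping is continuous. [folklore] -/
@[fun_prop]
theorem continuous_clamp : Continuous (clamp : (Fin k → ℝ) → Fin k → I) :=
  continuous_pi fun i => continuous_projIcc.comp (continuous_apply i)

/-- A point of norm `≥ 1` is clamped to the boundary of the cube. [folklore] -/
theorem clamp_mem_boundary {y : Fin k → ℝ} (hy : 1 ≤ ‖y‖) : clamp y ∈ Cube.boundary (Fin k) := by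
  by_contra hcon
  have hlt : ∀ i, ‖y i‖ < 1 := fun i => by
    rw [Real.norm_eq_abs, abs_lt]
    by_contra h
    rw [not_and_or, not_lt, not_lt] at h
    apply hcon
    refine ⟨i, ?_⟩
    rcases h with h | h
    · left; apply Subtype.ext
      simp only [clamp, coe_projIcc, Icc.coe_zero]
      rw [min_eq_right (by linarith : y i ≤ 1), max_eq_left (by linarith : y i ≤ 0)]
    · right; apply Subtype.ext
      simp only [clamp, coe_projIcc, Icc.coe_one]
      rw [min_eq_left h, max_eq_right zero_le_one]
  have := (pi_norm_lt_iff one_pos).2 hlt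
  linarith

/-- **The compactly supported sphere of a generalized loop**: `f ∘ clamp`. [folklore] -/
def ofGenLoop (f : Ω^ (Fin k) X x₀) : CSphere k X x₀ :=
  ⟨fun y => f (clamp y), f.1.continuous.comp continuous_clamp,
    ⟨1, fun _ hy => f.2 _ (clamp_mem_boundary hy)⟩⟩

/-- Unfolding `ofGenLoop`. [folklore] -/
@[simp] theorem ofGenLoop_apply (f : Ω^ (Fin k) X x₀) (z : Fin k → ℝ) :
    ofGenLoop f z = f (clamp z) := rfl

/-- **Every class is represented**: `toClass (ofGenLoop f) = ⟦f⟧`. The generalized loop of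
`ofGenLoop f` at radius `1` is `f ∘ (y ↦ clamp (2y - 1))`, homotopic rel `∂Iᵏ` to `f` through
`f ∘ (y ↦ clamp ((1 + s) y - s))`. [folklore] -/
theorem toClass_ofGenLoop (f : Ω^ (Fin k) X x₀) : (ofGenLoop f).toClass = ⟦f⟧ := by
  rw [(ofGenLoop f).toClass_eq zero_le_one fun y hy => f.2 _ (clamp_mem_boundary hy)]
  refine Quotient.sound (genLoop_homotopic_of_fun
    (fun p => f (clamp fun i => (2 - (p.1 : ℝ)) * (p.2 i : ℝ) - (1 - (p.1 : ℝ))))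
    (by fun_prop) (fun y => ?_) (fun y => ?_) fun t y hy => ?_)
  · simp only [toGenLoop_apply, ofGenLoop_apply]
    congr 1
    funext i
    simp only [stretch, clamp, Icc.coe_zero]
    congr 1; ring
  · show f (clamp fun i => (2 - 1) * (y i : ℝ) - (1 - 1)) = f y
    congr 1
    funext i
    apply Subtype.ext
    simp only [clamp, coe_projIcc]
    rw [show ((2 : ℝ) - 1) * (y i : ℝ) - (1 - 1) = y i by ring, min_eq_right (y i).2.2,
      max_eq_right (y i).2.1]
  · apply f.2
    obtain ⟨i, hi⟩ := hy
    refine ⟨i, ?_⟩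
    have ht0 : 0 ≤ (t : ℝ) := t.2.1
    have ht1 : (t : ℝ) ≤ 1 := t.2.2
    rcases hi with hi | hi
    · left; apply Subtype.ext
      simp only [clamp, hi, Icc.coe_zero, mul_zero, zero_sub, coe_projIcc]
      rw [max_eq_left]
      simp only [min_le_iff]; right; linarith
    · right; apply Subtype.ext
      simp only [clamp, hi, Icc.coe_one, mul_one, coe_projIcc, Icc.coe_one]
      rw [show (2 - (t : ℝ)) - (1 - (t : ℝ)) = 1 by ring, min_self, max_eq_right zero_le_one]

/-- **`toClass` is surjective**: every class in `πₖ(X, x₀)` is the class of a compactly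
supported sphere (namely of `ofGenLoop` of a representative). [folklore] -/
theorem toClass_surjective : Function.Surjective (toClass : CSphere k X x₀ → π_ k X x₀) := by
  intro a
  induction a using Quotient.inductionOn with
  | h f => exact ⟨ofGenLoop f, toClass_ofGenLoop f⟩

end CSphere

end Literature.AlgebraicTopology.Homotopy

end
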